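import Literature.AlgebraicGeometry.Motives.FanoSchemeOfLines
import Literature.AlgebraicGeometry.Motives.SegreEmbeddingPoints
import HarnessLib

/-!
# Scheme-theoretic preimages of `V₊(R)` and incidence correspondences in `X₁ ×ₖ X₂`

For a field `k` this file constructs, as `k`-schemes (`SchemeOver k = Over (Spec k)`):

* `ProjectiveSpace.preimageOfForms r R` — for a `k`-morphism `r : Y ⟶ ℙᴺ_k` and a set of
  polynomials `R ⊆ k[z₀, …, z_N]`, **the scheme-theoretic preimage `r⁻¹ V₊(R) = Y ×_{ℙᴺ} V₊(R)`**:
  the closed subscheme of `Y` whose quasi-coherent ideal sheaf (`preimageIdeal r R`) is generated by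
  the pulled-back sections `r^* g_d ∈ Γ(Y, r^*𝒪(d))` of the homogeneous components `g_d` of the
  `g ∈ R` — in chart form, by the functions `r^*(g_d / z_i^d)` on `r⁻¹ D₊(z_i)` (the zero scheme
  `GeneratingSections.Sec.zeroIdeal` of the section `GeneratingSections.secOfForm` of
  `Motives/SecOfForm`, `Motives/SecZeroScheme`; Görtz–Wedhorn I, (13.13): "`D_{i^*(H)} = i⁻¹(H)`,
  the schematic inverse image"; Hartshorne II Ex. 3.12 (b), II Cor. 5.16 (a)). For `r = 𝟙 ℙᴺ` this
  is the tree's `ProjectiveSpace.subschemeOfForms R` (`Motives/FanoSchemeOfLines`), verbatim the same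
  ideal sheaf (`preimageIdeal_id`). With its closed immersion `preimageOfFormsι r R : r⁻¹V₊(R) ⟶ Y`,
  whose image is `r⁻¹(V₊(R))` as a set when `r` is affine (`range_preimageOfFormsι`), and the
  `L`-points: an `L`-point of `Y` lifts to `r⁻¹ V₊(R)` iff its image in `ℙᴺ` lies on `V₊(R)`
  (`preimagePoint`, `exists_eq_preimagePoint`).
* `Incidence.subscheme ι₁ ι₂ R` — for `k`-morphisms `ι₁ : X₁ ⟶ ℙᵃ_k`, `ι₂ : X₂ ⟶ ℙᵇ_k` (typically
  closed immersions) and a set `R` of forms on the Segre space `ℙ^{ab+a+b}_k` (coordinates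
  `z_{(c,d)} = x_c y_d`, `segreIndexEquiv a b`), **the incidence correspondence
  `{(x₁, x₂) ∈ X₁ ×ₖ X₂ | R(ι₁ x₁ ⊗ ι₂ x₂) = 0}`**: the scheme-theoretic preimage of `V₊(R)` under
  `X₁ ×ₖ X₂ ⟶ ℙᵃ ×ₖ ℙᵇ ⟶ ℙ^{ab+a+b}` (`Incidence.toSegre`, the Segre embedding of
  `Motives/SegreEmbedding`). A bihomogeneous equation of bidegree `(d, d)` on `ℙᵃ × ℙᵇ` is a form of
  degree `d` in the `z_{(c,d)}`; bidegree `(d, e)` is reached after multiplying by all monomials of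
  degree `|d - e|` in the other variables, which does not change the subscheme. This is the
  standard construction of incidence correspondences / universal families as closed subschemes of a
  product (Eisenbud–Harris, *3264 and all that*, §3.2.3, PDF p. 135: the incidence correspondence
  `{(Λ, v) : v ∈ Λ}` is cut out by "bilinear functions in the coordinates of `v` and the Plücker
  coordinates", the universal `k`-plane `Φ = {(Λ, p) ∈ G × ℙV ∣ p ∈ Λ}`; §6.3, Prop. 6.5/6.6 for
  universal families; Hartshorne II Ex. 5.11 for the Segre dictionary). With:
  the closed immersion `Incidence.emb : subscheme ⟶ X₁ ⊗ X₂`, the projections `Incidence.fst`,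
  `Incidence.snd`, projectivity (`Incidence.isProjectiveOver`), and the **`L`-points**: for
  `L`-points `P₁`, `P₂` with homogeneous coordinates `z`, `w` (after `ι₁`, `ι₂`), the pair
  `(P₁, P₂)` lies on the incidence subscheme iff `g(z ⊗ w) = 0` for all `g ∈ R`
  (`Incidence.lift_mem_range_iff`, via `ProjectiveSpace.map_segreEmbedding_lift_pointOfVec` of
  `Motives/SegreEmbeddingPoints`), the lifted point `Incidence.point` and `Incidence.exists_eq_point`.

The universal line `{(ℓ, x) : x ∈ ℓ} ⊆ F₁(X) ×ₖ X` over the Fano scheme of lines is the instance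
worked out in `Motives/FanoUniversalLine`.

## What is NOT here

* Flatness / smoothness of the projections, fibres as schemes, bidegree-`(d, e)` equations as
  sections of `𝒪(d) ⊠ 𝒪(e)` (no external tensor products of the chart data here).

## References

* U. Görtz, T. Wedhorn, *Algebraic Geometry I*, 2nd ed. (2020), (13.13) pp. 504–505.
  [GortzWedhorn2020]
* R. Hartshorne, *Algebraic Geometry* (1977), II Ex. 3.12 (b), II Cor. 5.16 (a), II Ex. 5.11.
  [Hartshorne1977]
* D. Eisenbud, J. Harris, *3264 and All That* (2016), §3.2.3 (PDF pp. 134–135), §6.3 Prop. 6.5,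
  Prop. 6.6 (PDF pp. 228–230). [EisenbudHarris2016]
-/

noncomputable section

open CategoryTheory AlgebraicGeometry Limits MonoidalCategory CartesianMonoidalCategory
  MvPolynomial TopologicalSpace

universe u

namespace Literature.AlgebraicGeometry.Motives

attribute [local instance] MvPolynomial.gradedAlgebra

/-! ## Scheme-theoretic preimages `r⁻¹ V₊(R)` -/

namespace ProjectiveSpace

variable {k : Type u} [Field k] {N : ℕ} {Y : SchemeOver k} (r : Y ⟶ projectiveSpace N k)

/-- The ideal sheaf of the hypersurface section `r⁻¹ V₊(g) ⊆ Y` of a FORM `g` of degree `d`: the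
zero scheme of the pulled-back section `r^* g ∈ Γ(Y, r^*𝒪(d))`, generated on `r⁻¹ D₊(zᵢ)` by
`r^*(g / zᵢ^d)` (`GeneratingSections.secOfForm` for the data `ofHom r` of Hartshorne II Thm. 7.1 (a),
and its `zeroIdeal`). [cite: GortzWedhorn2020, Section (13.13)] -/
def secIdealSheaf (g : MvPolynomial (Fin (N + 1)) k) (d : ℕ) (hg : g.IsHomogeneous d) :
    Y.left.IdealSheafData :=
  ((GeneratingSections.ofHom r.left).secOfForm Y.hom g hg).zeroIdeal

/-- The support of the ideal sheaf of `r⁻¹ V₊(g)` (`deg g > 0`, `r` affine) is `r⁻¹(V₊(g))`: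
`y` lies on it iff `g ∈ 𝔭_{r(y)}`. [cite: GortzWedhorn2020, Section (13.13)] -/
theorem mem_support_secIdealSheaf_iff [IsAffineHom r.left] [QuasiSeparatedSpace Y.left]
    (g : MvPolynomial (Fin (N + 1)) k) {d : ℕ} (hd : 0 < d) (hg : g.IsHomogeneous d) (y : Y.left) :
    y ∈ (secIdealSheaf r g d hg).support ↔ g ∈ (r.left y).asHomogeneousIdeal := by
  -- the instance has to be found at the type `Y.left ⟶ Proj _` of `r.left`
  haveI : @IsAffineHom Y.left (Proj (Segre.grading (Fin (N + 1)) k)) r.left := ‹IsAffineHom r.left›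
  exact GeneratingSections.mem_support_zeroIdeal_secOfForm_ofHom_iff Y.hom r.left (Over.w r) hd g hg y

/-- The degree-`d` contribution of an arbitrary polynomial `g` to the ideal sheaf of `r⁻¹ V₊(g)`:
for `d ≥ 1` the ideal sheaf of `r⁻¹ V₊(g_d)`; for `d = 0` the unit ideal sheaf if the constant term
is non-zero and the zero ideal sheaf otherwise (as in `ProjectiveSpace.componentIdealSheaf`).
[folklore] -/
def componentSecIdealSheaf (g : MvPolynomial (Fin (N + 1)) k) : ℕ → Y.left.IdealSheafData
  | 0 => ⨆ (_ : constantCoeff g ≠ 0), ⊤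
  | (d + 1) => secIdealSheaf r (homogeneousComponent (d + 1) g) (d + 1)
      (homogeneousComponent_isHomogeneous (d + 1) g)

/-- `y` lies on the support of the degree-`d` contribution of `g` iff `g_d ∈ 𝔭_{r(y)}`.
[folklore] -/
theorem mem_support_componentSecIdealSheaf_iff [IsAffineHom r.left] [QuasiSeparatedSpace Y.left]
    (g : MvPolynomial (Fin (N + 1)) k) (d : ℕ) (y : Y.left) :
    y ∈ (componentSecIdealSheaf r g d).support ↔
      homogeneousComponent d g ∈ (r.left y).asHomogeneousIdeal := by
  cases d with
  | zero =>
    rw [componentSecIdealSheaf, Scheme.IdealSheafData.support_iSup, Closeds.mem_iInf,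
      homogeneousComponent_zero, ← constantCoeff_eq]
    by_cases hc : constantCoeff g = 0
    · constructor
      · intro _
        rw [hc, map_zero]
        exact Submodule.zero_mem _
      · intro _ h
        exact absurd hc h
    · constructor
      · intro h
        have h' := h hc
        rw [Scheme.IdealSheafData.support_top] at h'
        have h'' : y ∈ ((⊥ : Closeds Y.left) : Set Y.left) := h'
        rw [Closeds.coe_bot] at h''
        exact absurd h'' (Set.notMem_empty y)
      · intro h
        exfalso
        have hunit : IsUnit (C (constantCoeff g) : MvPolynomial (Fin (N + 1)) k) :=
          (isUnit_iff_ne_zero.mpr hc).map C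
        exact (r.left y).isPrime.ne_top (Ideal.eq_top_of_isUnit_mem _ h hunit)
  | succ d =>
    exact mem_support_secIdealSheaf_iff r _ d.succ_pos _ y

/-- **The ideal sheaf of `r⁻¹ V₊(R) ⊆ Y`** for a set `R ⊆ k[z₀, …, z_N]`: the quasi-coherent ideal
sheaf generated by the pulled-back sections of the homogeneous components of the elements of `R`.
[cite: GortzWedhorn2020, Section (13.13)] -/
def preimageIdeal (R : Set (MvPolynomial (Fin (N + 1)) k)) : Y.left.IdealSheafData :=
  ⨆ g ∈ R, ⨆ d : ℕ, componentSecIdealSheaf r g d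

/-- `y ∈ Supp 𝒪/𝓘_{r⁻¹V₊(R)}` iff `R ⊆ 𝔭_{r(y)}` (`r` affine). [folklore] -/
theorem mem_support_preimageIdeal_iff [IsAffineHom r.left] [QuasiSeparatedSpace Y.left]
    (R : Set (MvPolynomial (Fin (N + 1)) k)) (y : Y.left) :
    y ∈ (preimageIdeal r R).support ↔ R ⊆ (r.left y).asHomogeneousIdeal := by
  simp only [preimageIdeal, Scheme.IdealSheafData.support_iSup, Closeds.mem_iInf,
    mem_support_componentSecIdealSheaf_iff]
  constructor
  · intro h g hg
    rw [SetLike.mem_coe]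
    exact (mem_iff_homogeneousComponent_mem (r.left y).asHomogeneousIdeal.isHomogeneous g).mpr
      (h g hg)
  · intro h g hg d
    exact homogeneousComponent_mem_of_mem (r.left y).asHomogeneousIdeal.isHomogeneous (h hg) d

/-- **`Supp 𝒪/𝓘_{r⁻¹V₊(R)} = r⁻¹(V₊(R))`** as sets (`r` affine). [folklore] -/
theorem coe_support_preimageIdeal [IsAffineHom r.left] [QuasiSeparatedSpace Y.left]
    (R : Set (MvPolynomial (Fin (N + 1)) k)) :
    ((preimageIdeal r R).support : Set Y.left) = r.left ⁻¹' ProjectiveSpectrum.zeroLocus (MvPolynomial.homogeneousSubmodule (Fin (N + 1)) k) R :=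
  Set.ext fun y => mem_support_preimageIdeal_iff r R y

/-- The ideal sheaf of `r⁻¹ V₊(R)` is monotone in `R`. [folklore] -/
theorem preimageIdeal_mono {R T : Set (MvPolynomial (Fin (N + 1)) k)} (h : R ⊆ T) :
    preimageIdeal r R ≤ preimageIdeal r T :=
  iSup₂_le fun g hg => le_iSup₂ (f := fun g (_ : g ∈ T) => ⨆ d : ℕ, componentSecIdealSheaf r g d)
    g (h hg)

/-- For `r = 𝟙 ℙᴺ` the ideal sheaf of `r⁻¹ V₊(R)` is the tree's `zeroSchemeIdeal R` of
`V₊(R) ⊆ ℙᴺ` (`Motives/FanoSchemeOfLines`), definitionally. [folklore] -/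
theorem preimageIdeal_id (R : Set (MvPolynomial (Fin (N + 1)) k)) :
    preimageIdeal (𝟙 (projectiveSpace N k)) R = zeroSchemeIdeal R := rfl

/-- **The scheme-theoretic preimage `r⁻¹ V₊(R) = Y ×_{ℙᴺ} V₊(R)`** of the closed subscheme
`V₊(R) ⊆ ℙᴺ_k` under `r : Y ⟶ ℙᴺ_k`, as a `k`-scheme (Mathlib `IdealSheafData.subscheme` of
`preimageIdeal r R`; Görtz–Wedhorn I (13.13), "the schematic inverse image"; Hartshorne II
Ex. 3.12 (b), Cor. 5.16 (a)). [cite: GortzWedhorn2020, Section (13.13)] -/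
def preimageOfForms (R : Set (MvPolynomial (Fin (N + 1)) k)) : SchemeOver k :=
  Over.mk ((preimageIdeal r R).subschemeι ≫ Y.hom)

/-- The closed immersion `r⁻¹ V₊(R) ⟶ Y` over `k`. [folklore] -/
def preimageOfFormsι (R : Set (MvPolynomial (Fin (N + 1)) k)) : preimageOfForms r R ⟶ Y :=
  Over.homMk (preimageIdeal r R).subschemeι rfl

/-- `preimageOfFormsι` is Mathlib's `subschemeι` on underlying schemes (`rfl`). [folklore] -/
@[simp]
theorem preimageOfFormsι_left (R : Set (MvPolynomial (Fin (N + 1)) k)) :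
    (preimageOfFormsι r R).left = (preimageIdeal r R).subschemeι := rfl

/-- `r⁻¹ V₊(R) ⟶ Y` is a closed immersion. [folklore] -/
instance isClosedImmersion_preimageOfFormsι_left (R : Set (MvPolynomial (Fin (N + 1)) k)) :
    IsClosedImmersion (preimageOfFormsι r R).left :=
  inferInstanceAs (IsClosedImmersion (preimageIdeal r R).subschemeι)

/-- **The image of `r⁻¹ V₊(R) ⟶ Y` is `r⁻¹(V₊(R))`** (`r` affine). [folklore] -/
theorem range_preimageOfFormsι [IsAffineHom r.left] [QuasiSeparatedSpace Y.left]
    (R : Set (MvPolynomial (Fin (N + 1)) k)) :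
    Set.range (preimageOfFormsι r R).left = r.left ⁻¹' ProjectiveSpectrum.zeroLocus (MvPolynomial.homogeneousSubmodule (Fin (N + 1)) k) R := by
  refine (Scheme.IdealSheafData.range_subschemeι (preimageIdeal r R)).trans ?_
  exact coe_support_preimageIdeal r R

/-- `r⁻¹ V₊(R)` is projective over `k` when `Y` is. [folklore] -/
theorem isProjectiveOver_preimageOfForms (hY : IsProjectiveOver Y)
    (R : Set (MvPolynomial (Fin (N + 1)) k)) : IsProjectiveOver (preimageOfForms r R) := by
  obtain ⟨M, κ, hκ⟩ := hY
  exact ⟨M, preimageOfFormsι r R ≫ κ, by rw [Over.comp_left]; infer_instance⟩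

/-- `r⁻¹ V₊(T) ⟶ r⁻¹ V₊(R)` for `R ⊆ T`, over `Y`. [folklore] -/
def preimageOfFormsInclusion {R T : Set (MvPolynomial (Fin (N + 1)) k)} (h : R ⊆ T) :
    preimageOfForms r T ⟶ preimageOfForms r R :=
  Over.homMk (Scheme.IdealSheafData.inclusion (preimageIdeal_mono r h)) (by
    change Scheme.IdealSheafData.inclusion _ ≫ (preimageIdeal r R).subschemeι ≫ _ =
      (preimageIdeal r T).subschemeι ≫ _
    rw [Scheme.IdealSheafData.inclusion_subschemeι_assoc])

/-- The inclusion `r⁻¹ V₊(T) ⟶ r⁻¹ V₊(R)` commutes with the immersions into `Y`. [folklore] -/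
@[simp]
theorem preimageOfFormsInclusion_ι {R T : Set (MvPolynomial (Fin (N + 1)) k)} (h : R ⊆ T) :
    preimageOfFormsInclusion r h ≫ preimageOfFormsι r R = preimageOfFormsι r T := by
  ext : 1
  exact Scheme.IdealSheafData.inclusion_subschemeι (preimageIdeal_mono r h)

/-! ### `L`-points of `r⁻¹ V₊(R)` -/

section Points

variable {L : Type u} [Field L] [Algebra k L]

/-- An `L`-point `P` of `Y` whose image `r(P)` has homogeneous coordinates `z` lies over
`r⁻¹(V₊(R))` iff every `g ∈ R` vanishes at `z` (`R` consisting of forms of positive degree, `r`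
affine). [folklore] -/
theorem pt_mem_range_preimageOfFormsι_iff [IsAffineHom r.left] [QuasiSeparatedSpace Y.left]
    {R : Set (MvPolynomial (Fin (N + 1)) k)} (hR : ∀ g ∈ R, ∃ m, 0 < m ∧ g.IsHomogeneous m)
    (P : AlgPoints Y L) (z : Fin (N + 1) → L) (hz : z ≠ 0)
    (hP : AlgPoints.map r P = pointOfVec k z hz) :
    P.pt ∈ Set.range (preimageOfFormsι r R).left ↔ ∀ g ∈ R, aeval z g = 0 := by
  rw [range_preimageOfFormsι, Set.mem_preimage, ← pt_pointOfVec_mem_zeroLocus_set_iff hR z hz,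
    ← hP, AlgPoints.pt_map]
  exact Iff.rfl

/-- **The `L`-point of `r⁻¹ V₊(R)` under an `L`-point `P` of `Y` with `R(r(P)) = 0`** (lift through
the closed immersion; `Spec L` is reduced). [folklore] -/
def preimagePoint [IsAffineHom r.left] [QuasiSeparatedSpace Y.left]
    {R : Set (MvPolynomial (Fin (N + 1)) k)} (hR : ∀ g ∈ R, ∃ m, 0 < m ∧ g.IsHomogeneous m)
    (P : AlgPoints Y L) (z : Fin (N + 1) → L) (hz : z ≠ 0)
    (hP : AlgPoints.map r P = pointOfVec k z hz) (hzR : ∀ g ∈ R, aeval z g = 0) :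
    AlgPoints (preimageOfForms r R) L :=
  P.liftClosed (preimageOfFormsι r R) ((pt_mem_range_preimageOfFormsι_iff r hR P z hz hP).mpr hzR)

/-- The lifted point maps back to `P`. [folklore] -/
@[simp]
theorem map_preimagePoint [IsAffineHom r.left] [QuasiSeparatedSpace Y.left]
    {R : Set (MvPolynomial (Fin (N + 1)) k)} (hR : ∀ g ∈ R, ∃ m, 0 < m ∧ g.IsHomogeneous m)
    (P : AlgPoints Y L) (z : Fin (N + 1) → L) (hz : z ≠ 0)
    (hP : AlgPoints.map r P = pointOfVec k z hz) (hzR : ∀ g ∈ R, aeval z g = 0) :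
    AlgPoints.map (preimageOfFormsι r R) (preimagePoint r hR P z hz hP hzR) = P :=
  AlgPoints.map_liftClosed _ _ _

/-- **Every `L`-point of `r⁻¹ V₊(R)` is the lift of an `L`-point `P` of `Y` with `R(r(P)) = 0`.**
[folklore] -/
theorem exists_eq_preimagePoint [IsAffineHom r.left] [QuasiSeparatedSpace Y.left]
    {R : Set (MvPolynomial (Fin (N + 1)) k)} (hR : ∀ g ∈ R, ∃ m, 0 < m ∧ g.IsHomogeneous m)
    (Q : AlgPoints (preimageOfForms r R) L) :
    ∃ (P : AlgPoints Y L) (z : Fin (N + 1) → L) (hz : z ≠ 0)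
      (hP : AlgPoints.map r P = pointOfVec k z hz) (hzR : ∀ g ∈ R, aeval z g = 0),
      Q = preimagePoint r hR P z hz hP hzR := by
  obtain ⟨z, hz, hPz⟩ := exists_eq_pointOfVec (AlgPoints.map r (AlgPoints.map (preimageOfFormsι r R) Q))
  have hmem : (AlgPoints.map (preimageOfFormsι r R) Q).pt ∈ Set.range (preimageOfFormsι r R).left :=
    AlgPoints.pt_map_mem_range _ Q
  refine ⟨AlgPoints.map (preimageOfFormsι r R) Q, z, hz, hPz,
    (pt_mem_range_preimageOfFormsι_iff r hR _ z hz hPz).mp hmem, ?_⟩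
  apply AlgPoints.map_injective_of_mono (preimageOfFormsι r R)
  rw [map_preimagePoint]

end Points

/-! ### The vector of Segre coordinates `z ⊗ w` -/

section SegreVec

variable {a b : ℕ} {L : Type u} [Field L] [Algebra k L]

/-- **`z ⊗ w`**, the vector of Segre coordinates `(z ⊗ w)_{(c,d)} = z_c w_d` (lexicographic
enumeration `segreIndexEquiv a b` of `Motives/SegreEmbedding`): the homogeneous coordinates of the
Segre image of `([z], [w])` (`map_segreEmbedding_lift_pointOfVec`, Hartshorne I Ex. 2.14).
[cite: Hartshorne1977, I Ex. 2.14] -/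
def segreVec (z : Fin (a + 1) → L) (w : Fin (b + 1) → L) : Fin (a * b + a + b + 1) → L :=
  fun t => z ((segreIndexEquiv a b).symm t).1 * w ((segreIndexEquiv a b).symm t).2

/-- `(z ⊗ w)_{(c,d)} = z_c w_d`. [folklore] -/
@[simp]
theorem segreVec_apply_segreIndexEquiv (z : Fin (a + 1) → L) (w : Fin (b + 1) → L)
    (c : Fin (a + 1)) (d : Fin (b + 1)) : segreVec z w (segreIndexEquiv a b (c, d)) = z c * w d := by
  simp [segreVec]

/-- Unfolding `z ⊗ w` at an arbitrary index. [folklore] -/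
theorem segreVec_apply' (z : Fin (a + 1) → L) (w : Fin (b + 1) → L) (t : Fin (a * b + a + b + 1)) :
    segreVec z w t = z ((segreIndexEquiv a b).symm t).1 * w ((segreIndexEquiv a b).symm t).2 := rfl

/-- The Segre coordinate `z_{(c,d)}` evaluates at `z ⊗ w` to `z_c w_d`. [folklore] -/
@[simp]
theorem aeval_segreVec_X (z : Fin (a + 1) → L) (w : Fin (b + 1) → L) (c : Fin (a + 1))
    (d : Fin (b + 1)) :
    aeval (segreVec z w) (X (segreIndexEquiv a b (c, d)) : MvPolynomial _ k) = z c * w d := by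
  rw [aeval_X, segreVec_apply_segreIndexEquiv]

/-- `z ⊗ w ≠ 0` for `z, w ≠ 0`. [folklore] -/
theorem segreVec_ne_zero' {z : Fin (a + 1) → L} {w : Fin (b + 1) → L} (hz : z ≠ 0) (hw : w ≠ 0) :
    segreVec z w ≠ 0 :=
  segreVec_ne_zero hz hw

/-- **The Segre embedding on homogeneous coordinates**, `([z], [w]) ↦ [z ⊗ w]`
(`map_segreEmbedding_lift_pointOfVec` of `Motives/SegreEmbeddingPoints`, restated with `segreVec`).
[cite: Hartshorne1977, I Ex. 2.14 and II Ex. 5.11] -/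
theorem map_segreEmbedding_lift_pointOfVec' (z : Fin (a + 1) → L) (hz : z ≠ 0)
    (w : Fin (b + 1) → L) (hw : w ≠ 0) :
    AlgPoints.map (segreEmbedding a b k) (lift (pointOfVec k z hz) (pointOfVec k w hw)) =
      pointOfVec k (segreVec z w) (segreVec_ne_zero' hz hw) :=
  map_segreEmbedding_lift_pointOfVec z hz w hw

end SegreVec

end ProjectiveSpace

/-! ## Incidence correspondences in `X₁ ×ₖ X₂` cut out by forms on the Segre space -/

namespace Incidence

open ProjectiveSpace

variable {k : Type u} [Field k] {a b : ℕ} {X₁ X₂ : SchemeOver k}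
  (ι₁ : X₁ ⟶ projectiveSpace a k) (ι₂ : X₂ ⟶ projectiveSpace b k)

/-- The morphism `X₁ ×ₖ X₂ ⟶ ℙᵃ ×ₖ ℙᵇ ⟶ ℙ^{ab+a+b}`, `(x₁, x₂) ↦ [ι₁(x₁) ⊗ ι₂(x₂)]`: `ι₁ × ι₂`
followed by the Segre embedding. [cite: Hartshorne1977, II Ex. 5.11] -/
def toSegre : X₁ ⊗ X₂ ⟶ projectiveSpace (a * b + a + b) k :=
  (ι₁ ⊗ₘ ι₂) ≫ segreEmbedding a b k

/-- Unfolding `toSegre` on underlying schemes. [folklore] -/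
theorem toSegre_left :
    (toSegre ι₁ ι₂).left = (ι₁ ⊗ₘ ι₂).left ≫ (segreEmbedding a b k).left := rfl

/-- For closed immersions `ι₁`, `ι₂` the morphism `X₁ ×ₖ X₂ ⟶ ℙ^{ab+a+b}` is a closed immersion
(products of closed immersions, and the Segre embedding, are). [cite: Hartshorne1977, II Ex. 4.9] -/
instance isClosedImmersion_toSegre_left [IsClosedImmersion ι₁.left] [IsClosedImmersion ι₂.left] :
    IsClosedImmersion (toSegre ι₁ ι₂).left := by
  have := isClosedImmersion_tensorHom_left ι₁ ι₂
  rw [toSegre_left]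
  infer_instance

/-- For closed immersions `ι₁`, `ι₂` the product `X₁ ×ₖ X₂` is quasi-separated (it embeds into a
projective space). [folklore] -/
theorem quasiSeparatedSpace_tensorObj_left [IsClosedImmersion ι₁.left] [IsClosedImmersion ι₂.left] :
    QuasiSeparatedSpace (X₁ ⊗ X₂).left :=
  haveI : QuasiSeparatedSpace (projectiveSpace (a * b + a + b) k).left :=
    inferInstanceAs
      (QuasiSeparatedSpace (Proj (MvPolynomial.homogeneousSubmodule (Fin (a * b + a + b + 1)) k)))
  quasiSeparatedSpace_of_quasiSeparated (toSegre ι₁ ι₂).left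

variable (R : Set (MvPolynomial (Fin (a * b + a + b + 1)) k))

/-- **The incidence correspondence `{(x₁, x₂) ∈ X₁ ×ₖ X₂ | R(ι₁x₁ ⊗ ι₂x₂) = 0}`** cut out by a set
`R` of forms on the Segre space `ℙ^{ab+a+b}` (coordinates `z_{(c,d)} = x_c y_d`): the
scheme-theoretic preimage of `V₊(R)` under `X₁ ×ₖ X₂ ⟶ ℙ^{ab+a+b}` (`ProjectiveSpace.preimageOfForms`).
Bihomogeneous equations of bidegree `(d, d)` in `(x, y)` are exactly the forms of degree `d` in the
`z_{(c,d)}` restricted along the Segre embedding; this is the standard realisation of incidence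
correspondences and universal families as closed subschemes of a product (Eisenbud–Harris, *3264
and all that*, §3.2.3, PDF p. 135, and §6.3; Hartshorne II Ex. 5.11). [cite: EisenbudHarris2016, §3.2.3] -/
def subscheme : SchemeOver k :=
  preimageOfForms (toSegre ι₁ ι₂) R

/-- The closed immersion of the incidence correspondence into `X₁ ×ₖ X₂`. [folklore] -/
def emb : subscheme ι₁ ι₂ R ⟶ X₁ ⊗ X₂ :=
  preimageOfFormsι (toSegre ι₁ ι₂) R

/-- `emb` is Mathlib's `subschemeι` of the incidence ideal sheaf (`rfl`). [folklore] -/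
@[simp]
theorem emb_left : (emb ι₁ ι₂ R).left = (preimageIdeal (toSegre ι₁ ι₂) R).subschemeι := rfl

/-- The incidence correspondence is a closed subscheme of `X₁ ×ₖ X₂`. [folklore] -/
instance isClosedImmersion_emb_left : IsClosedImmersion (emb ι₁ ι₂ R).left :=
  ProjectiveSpace.isClosedImmersion_preimageOfFormsι_left _ _

/-- The first projection `{(x₁, x₂) | …} ⟶ X₁`. [folklore] -/
def fst : subscheme ι₁ ι₂ R ⟶ X₁ :=
  emb ι₁ ι₂ R ≫ CartesianMonoidalCategory.fst X₁ X₂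

/-- The second projection `{(x₁, x₂) | …} ⟶ X₂`. [folklore] -/
def snd : subscheme ι₁ ι₂ R ⟶ X₂ :=
  emb ι₁ ι₂ R ≫ CartesianMonoidalCategory.snd X₁ X₂

/-- Unfolding: `fst = emb ≫ pr₁` on underlying schemes. [folklore] -/
theorem fst_left : (fst ι₁ ι₂ R).left =
    (preimageIdeal (toSegre ι₁ ι₂) R).subschemeι ≫ pullback.fst X₁.hom X₂.hom := rfl

/-- Unfolding: `snd = emb ≫ pr₂` on underlying schemes. [folklore] -/
theorem snd_left : (snd ι₁ ι₂ R).left =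
    (preimageIdeal (toSegre ι₁ ι₂) R).subschemeι ≫ pullback.snd X₁.hom X₂.hom := rfl

/-- **The underlying set of the incidence correspondence** is
`{(x₁, x₂) | [ι₁x₁ ⊗ ι₂x₂] ∈ V₊(R)}` (closed immersions `ι₁`, `ι₂`). [folklore] -/
theorem range_emb [IsClosedImmersion ι₁.left] [IsClosedImmersion ι₂.left] :
    Set.range (emb ι₁ ι₂ R).left =
      (toSegre ι₁ ι₂).left ⁻¹'
        ProjectiveSpectrum.zeroLocus (MvPolynomial.homogeneousSubmodule (Fin (a * b + a + b + 1)) k) R :=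
  haveI := quasiSeparatedSpace_tensorObj_left ι₁ ι₂
  range_preimageOfFormsι (toSegre ι₁ ι₂) R

/-- The incidence correspondence is projective over `k` (closed immersions `ι₁`, `ι₂`): it is a
closed subscheme of `X₁ ×ₖ X₂ ↪ ℙ^{ab+a+b}`. [cite: Hartshorne1977, II Ex. 4.9] -/
theorem isProjectiveOver [IsClosedImmersion ι₁.left] [IsClosedImmersion ι₂.left] :
    IsProjectiveOver (subscheme ι₁ ι₂ R) :=
  isProjectiveOver_preimageOfForms (toSegre ι₁ ι₂) ⟨_, toSegre ι₁ ι₂, inferInstance⟩ R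

/-- The first projection is proper when `X₂ → Spec k` is (closed immersion followed by a base
change of `X₂ → Spec k`). [folklore] -/
theorem isProper_fst_left [IsProper X₂.hom] : IsProper (fst ι₁ ι₂ R).left := by
  have h₁ : IsProper (preimageIdeal (toSegre ι₁ ι₂) R).subschemeι := inferInstance
  have h₂ : IsProper (pullback.fst X₁.hom X₂.hom) := inferInstance
  exact MorphismProperty.comp_mem @IsProper _ _ h₁ h₂

/-- The second projection is proper when `X₁ → Spec k` is. [folklore] -/
theorem isProper_snd_left [IsProper X₁.hom] : IsProper (snd ι₁ ι₂ R).left := by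
  have h₁ : IsProper (preimageIdeal (toSegre ι₁ ι₂) R).subschemeι := inferInstance
  have h₂ : IsProper (pullback.snd X₁.hom X₂.hom) := inferInstance
  exact MorphismProperty.comp_mem @IsProper _ _ h₁ h₂

/-! ### `L`-points of the incidence correspondence -/

section Points

variable {L : Type u} [Field L] [Algebra k L]

/-- `toSegre` on a pair of `L`-points: `(P₁, P₂) ↦ segre (ι₁P₁, ι₂P₂)`. [folklore] -/
theorem map_toSegre_lift (P₁ : AlgPoints X₁ L) (P₂ : AlgPoints X₂ L) :
    AlgPoints.map (toSegre ι₁ ι₂) (lift P₁ P₂) =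
      AlgPoints.map (segreEmbedding a b k) (lift (AlgPoints.map ι₁ P₁) (AlgPoints.map ι₂ P₂)) := by
  simp only [AlgPoints.map_apply, toSegre, ← Category.assoc, lift_map]

/-- If `ι₁P₁ = [z]` and `ι₂P₂ = [w]` then `toSegre (P₁, P₂) = [z ⊗ w]`. [folklore] -/
theorem map_toSegre_lift_eq_pointOfVec (P₁ : AlgPoints X₁ L) (z : Fin (a + 1) → L) (hz : z ≠ 0)
    (h₁ : AlgPoints.map ι₁ P₁ = pointOfVec k z hz) (P₂ : AlgPoints X₂ L) (w : Fin (b + 1) → L)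
    (hw : w ≠ 0) (h₂ : AlgPoints.map ι₂ P₂ = pointOfVec k w hw) :
    AlgPoints.map (toSegre ι₁ ι₂) (lift P₁ P₂) =
      pointOfVec k (segreVec z w) (segreVec_ne_zero' hz hw) := by
  rw [map_toSegre_lift, h₁, h₂, map_segreEmbedding_lift_pointOfVec']

variable {R}

/-- **Membership criterion**: for `L`-points `P₁`, `P₂` with `ι₁P₁ = [z]`, `ι₂P₂ = [w]`, the pair
`(P₁, P₂)` lies on the incidence correspondence iff `g(z ⊗ w) = 0` for all `g ∈ R` (`R` consisting
of forms of positive degree; `ι₁`, `ι₂` closed immersions). [folklore] -/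
theorem pt_lift_mem_range_emb_iff [IsClosedImmersion ι₁.left] [IsClosedImmersion ι₂.left]
    (hR : ∀ g ∈ R, ∃ m, 0 < m ∧ g.IsHomogeneous m)
    (P₁ : AlgPoints X₁ L) (z : Fin (a + 1) → L) (hz : z ≠ 0)
    (h₁ : AlgPoints.map ι₁ P₁ = pointOfVec k z hz) (P₂ : AlgPoints X₂ L) (w : Fin (b + 1) → L)
    (hw : w ≠ 0) (h₂ : AlgPoints.map ι₂ P₂ = pointOfVec k w hw) :
    AlgPoints.pt (lift P₁ P₂) ∈ Set.range (emb ι₁ ι₂ R).left ↔ ∀ g ∈ R, aeval (segreVec z w) g = 0 :=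
  haveI := quasiSeparatedSpace_tensorObj_left ι₁ ι₂
  pt_mem_range_preimageOfFormsι_iff (toSegre ι₁ ι₂) hR (lift P₁ P₂) (segreVec z w)
    (segreVec_ne_zero' hz hw) (map_toSegre_lift_eq_pointOfVec ι₁ ι₂ P₁ z hz h₁ P₂ w hw h₂)

/-- **The `L`-point `(P₁, P₂)` of the incidence correspondence**, for `L`-points with
`ι₁P₁ = [z]`, `ι₂P₂ = [w]` and `R(z ⊗ w) = 0`. [folklore] -/
def point [IsClosedImmersion ι₁.left] [IsClosedImmersion ι₂.left]
    (hR : ∀ g ∈ R, ∃ m, 0 < m ∧ g.IsHomogeneous m)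
    (P₁ : AlgPoints X₁ L) (z : Fin (a + 1) → L) (hz : z ≠ 0)
    (h₁ : AlgPoints.map ι₁ P₁ = pointOfVec k z hz) (P₂ : AlgPoints X₂ L) (w : Fin (b + 1) → L)
    (hw : w ≠ 0) (h₂ : AlgPoints.map ι₂ P₂ = pointOfVec k w hw)
    (hzw : ∀ g ∈ R, aeval (segreVec z w) g = 0) : AlgPoints (subscheme ι₁ ι₂ R) L :=
  haveI := quasiSeparatedSpace_tensorObj_left ι₁ ι₂
  preimagePoint (toSegre ι₁ ι₂) hR (lift P₁ P₂) (segreVec z w) (segreVec_ne_zero' hz hw)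
    (map_toSegre_lift_eq_pointOfVec ι₁ ι₂ P₁ z hz h₁ P₂ w hw h₂) hzw

/-- The point `(P₁, P₂)` of the incidence correspondence maps to `(P₁, P₂) ∈ (X₁ ×ₖ X₂)(L)`.
[folklore] -/
@[simp]
theorem map_emb_point [IsClosedImmersion ι₁.left] [IsClosedImmersion ι₂.left]
    (hR : ∀ g ∈ R, ∃ m, 0 < m ∧ g.IsHomogeneous m)
    (P₁ : AlgPoints X₁ L) (z : Fin (a + 1) → L) (hz : z ≠ 0)
    (h₁ : AlgPoints.map ι₁ P₁ = pointOfVec k z hz) (P₂ : AlgPoints X₂ L) (w : Fin (b + 1) → L)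
    (hw : w ≠ 0) (h₂ : AlgPoints.map ι₂ P₂ = pointOfVec k w hw)
    (hzw : ∀ g ∈ R, aeval (segreVec z w) g = 0) :
    AlgPoints.map (emb ι₁ ι₂ R) (point ι₁ ι₂ hR P₁ z hz h₁ P₂ w hw h₂ hzw) = lift P₁ P₂ :=
  haveI := quasiSeparatedSpace_tensorObj_left ι₁ ι₂
  map_preimagePoint (toSegre ι₁ ι₂) hR (lift P₁ P₂) (segreVec z w) (segreVec_ne_zero' hz hw)
    (map_toSegre_lift_eq_pointOfVec ι₁ ι₂ P₁ z hz h₁ P₂ w hw h₂) hzw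

/-- The first projection of the point `(P₁, P₂)` is `P₁`. [folklore] -/
@[simp]
theorem map_fst_point [IsClosedImmersion ι₁.left] [IsClosedImmersion ι₂.left]
    (hR : ∀ g ∈ R, ∃ m, 0 < m ∧ g.IsHomogeneous m)
    (P₁ : AlgPoints X₁ L) (z : Fin (a + 1) → L) (hz : z ≠ 0)
    (h₁ : AlgPoints.map ι₁ P₁ = pointOfVec k z hz) (P₂ : AlgPoints X₂ L) (w : Fin (b + 1) → L)
    (hw : w ≠ 0) (h₂ : AlgPoints.map ι₂ P₂ = pointOfVec k w hw)
    (hzw : ∀ g ∈ R, aeval (segreVec z w) g = 0) :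
    AlgPoints.map (fst ι₁ ι₂ R) (point ι₁ ι₂ hR P₁ z hz h₁ P₂ w hw h₂ hzw) = P₁ := by
  rw [fst, AlgPoints.map_comp_apply, map_emb_point, AlgPoints.map_apply, lift_fst]

/-- The second projection of the point `(P₁, P₂)` is `P₂`. [folklore] -/
@[simp]
theorem map_snd_point [IsClosedImmersion ι₁.left] [IsClosedImmersion ι₂.left]
    (hR : ∀ g ∈ R, ∃ m, 0 < m ∧ g.IsHomogeneous m)
    (P₁ : AlgPoints X₁ L) (z : Fin (a + 1) → L) (hz : z ≠ 0)
    (h₁ : AlgPoints.map ι₁ P₁ = pointOfVec k z hz) (P₂ : AlgPoints X₂ L) (w : Fin (b + 1) → L)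
    (hw : w ≠ 0) (h₂ : AlgPoints.map ι₂ P₂ = pointOfVec k w hw)
    (hzw : ∀ g ∈ R, aeval (segreVec z w) g = 0) :
    AlgPoints.map (snd ι₁ ι₂ R) (point ι₁ ι₂ hR P₁ z hz h₁ P₂ w hw h₂ hzw) = P₂ := by
  rw [snd, AlgPoints.map_comp_apply, map_emb_point, AlgPoints.map_apply, lift_snd]

/-- **Every `L`-point of the incidence correspondence is a pair `(P₁, P₂)` with `R(z ⊗ w) = 0`**,
`[z] = ι₁P₁`, `[w] = ι₂P₂`. [folklore] -/
theorem exists_eq_point [IsClosedImmersion ι₁.left] [IsClosedImmersion ι₂.left]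
    (hR : ∀ g ∈ R, ∃ m, 0 < m ∧ g.IsHomogeneous m) (Q : AlgPoints (subscheme ι₁ ι₂ R) L) :
    ∃ (P₁ : AlgPoints X₁ L) (z : Fin (a + 1) → L) (hz : z ≠ 0)
      (h₁ : AlgPoints.map ι₁ P₁ = pointOfVec k z hz) (P₂ : AlgPoints X₂ L) (w : Fin (b + 1) → L)
      (hw : w ≠ 0) (h₂ : AlgPoints.map ι₂ P₂ = pointOfVec k w hw)
      (hzw : ∀ g ∈ R, aeval (segreVec z w) g = 0),
      Q = point ι₁ ι₂ hR P₁ z hz h₁ P₂ w hw h₂ hzw := by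
  set P := AlgPoints.map (emb ι₁ ι₂ R) Q with hPdef
  obtain ⟨z, hz, h₁⟩ := exists_eq_pointOfVec (AlgPoints.map ι₁ (AlgPoints.map (CartesianMonoidalCategory.fst X₁ X₂) P))
  obtain ⟨w, hw, h₂⟩ := exists_eq_pointOfVec (AlgPoints.map ι₂ (AlgPoints.map (CartesianMonoidalCategory.snd X₁ X₂) P))
  have hP : P = lift (AlgPoints.map (CartesianMonoidalCategory.fst X₁ X₂) P)
      (AlgPoints.map (CartesianMonoidalCategory.snd X₁ X₂) P) :=
    (AlgPoints.prodEquiv.symm_apply_apply P).symm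
  have hmem : AlgPoints.pt (lift (AlgPoints.map (CartesianMonoidalCategory.fst X₁ X₂) P)
      (AlgPoints.map (CartesianMonoidalCategory.snd X₁ X₂) P)) ∈ Set.range (emb ι₁ ι₂ R).left := by
    rw [← hP]
    exact AlgPoints.pt_map_mem_range _ Q
  refine ⟨_, z, hz, h₁, _, w, hw, h₂, (pt_lift_mem_range_emb_iff ι₁ ι₂ hR _ z hz h₁ _ w hw h₂).mp hmem,
    ?_⟩
  apply AlgPoints.map_injective_of_mono (emb ι₁ ι₂ R)
  rw [map_emb_point, ← hP]

end Points

end Incidence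

end Literature.AlgebraicGeometry.Motives
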